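import Literature.MathematicalPhysics.QuantumManyBody.JelliumSlicePQBridge
import HarnessLib

/-!
# Bochner fibre integration on `Λⁿ` and the self-adjointness of `Pᵢ` (transported from the PQ calculus)

Topic `Literature/MathematicalPhysics/QuantumManyBody` (the charged Bose gas, `JelliumBoseGas.foldyLaw`).
The complex-valued (Bochner) counterparts of the `ℝ≥0∞` fibre tools used so far, needed for the
signed cross terms of [LiebSolovej2001, Lemma 5.5] (`ŵ_{p0,00}`): they are the tree's Fournais `PQ`
calculus (`PeriodicBoseGasPQ.lean`: `integral_integral_update`, `integral_conj_mul_nbodyP`) on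
`boxConfig (n+1) ℓ u₀`, transported to `cellN (n+1) ℓ` and `sliceMean` through
`JelliumSlicePQBridge.lean` (`cellN = boxConfig n ℓ u₀`, `cell = Λ(u₀)` a.e., `sliceMean = nbodyP ℓ u₀`):

* `integral_cellN_integral_cell_update` — `∫_{Λⁿ⁺¹}∫_Λ K(X;xᵢ↦y)dy dX = ℓ³∫_{Λⁿ⁺¹}K`;
* `integral_cellN_weight_of_update_invariant'` — Bochner dummy integration
  `∫_{Λⁿ⁺¹} g(xᵢ)K = ℓ⁻³(∫_Λ g)∫_{Λⁿ⁺¹}K` for `K` independent of `xᵢ`;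
* `integral_conj_mul_sliceMean` — **`⟨H, PᵢG⟩ = ⟨H, G⟩` for `H` independent of `xᵢ`** (`Pᵢ` is the
  orthogonal projection onto such functions).

## References

* [LiebSolovej2001] E. H. Lieb, J. P. Solovej, Commun. Math. Phys. 217 (2001) 127–163, §5.
* [Fournais2020] S. Fournais, EMS Ser. Congr. Rep. 18 (2021), (2.5), (2.15).
-/

noncomputable section

open MeasureTheory Set Filter Real
open scoped ENNReal NNReal Topology ComplexConjugate

namespace Literature.MathematicalPhysics.QuantumManyBody.JelliumBoseGas

open BoseGas

variable {n : ℕ} {ℓ : ℝ}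

/-- **Fibre integration (Bochner)**: for `K ∈ L¹(Λⁿ⁺¹)`,
`∫_{Λⁿ⁺¹}∫_Λ K(X; xᵢ ↦ y) dy dX = ℓ³ ∫_{Λⁿ⁺¹} K`. [cite: Fournais2020, (2.5)] -/
theorem integral_cellN_integral_cell_update (i : Fin (n + 1)) {K : Config (n + 1) → ℂ}
    (hK : IntegrableOn K (cellN (n + 1) ℓ)) :
    ∫ X in cellN (n + 1) ℓ, ∫ y in cell ℓ, K (Function.update X i y) =
      (ℓ ^ 3 : ℝ) • ∫ X in cellN (n + 1) ℓ, K X := by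
  have hset := cellN_ae_eq_boxConfig (n + 1) ℓ
  have hK' : Integrable K ((volume : Measure (Config (n + 1))).restrict
      (boxConfig (n + 1) ℓ (WithLp.toLp 2 fun _ : Fin 3 => ℓ / 2))) := by
    rw [← Measure.restrict_congr_set hset]; exact hK
  have h := integral_integral_update (ℓ := ℓ) (u := (WithLp.toLp 2 fun _ : Fin 3 => ℓ / 2)) i hK'
  rw [setIntegral_congr_set hset, setIntegral_congr_set hset]
  have hinner : ∀ X : Config (n + 1),
      ∫ y in slidingBox ℓ (WithLp.toLp 2 fun _ : Fin 3 => ℓ / 2), K (Function.update X i y) =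
        ∫ y in cell ℓ, K (Function.update X i y) := fun X =>
    setIntegral_congr_set (slidingBox_center_ae_eq_cell ℓ)
  simp_rw [hinner] at h
  exact h

/-- **Dummy integration (Bochner)**: for `K ∈ L¹(Λⁿ⁺¹)` independent of `xᵢ`, continuous, and a
bounded measurable weight `g` on `Λ`, `∫_{Λⁿ⁺¹} g(xᵢ)K = ℓ⁻³(∫_Λ g)∫_{Λⁿ⁺¹} K` (`ℓ > 0`).
[cite: LiebSolovej2001, Lemma 5.5 (proof)] -/
theorem integral_cellN_weight_of_update_invariant' (hℓ : 0 < ℓ) (i : Fin (n + 1))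
    {g : Space → ℝ} (hg : Measurable g) {Gb : ℝ} (hGb : ∀ y, |g y| ≤ Gb)
    {K : Config (n + 1) → ℂ} (hKm : Measurable K) {C : ℝ} (hC : ∀ X ∈ cellN (n + 1) ℓ, ‖K X‖ ≤ C)
    (hKi : ∀ X z, K (Function.update X i z) = K X) :
    ∫ X in cellN (n + 1) ℓ, (g (X i) : ℂ) * K X =
      ((ℓ ^ 3)⁻¹ * ∫ y in cell ℓ, g y : ℝ) • ∫ X in cellN (n + 1) ℓ, K X := by
  have hvol : volume (cellN (n + 1) ℓ) ≠ ⊤ := by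
    rw [volume_cellN]; exact ENNReal.pow_ne_top (ENNReal.pow_ne_top ENNReal.ofReal_ne_top)
  haveI := isFiniteMeasure_restrict_cell ℓ
  -- integrability of `g(xᵢ)K`
  have hm : Measurable fun X : Config (n + 1) => (g (X i) : ℂ) * K X :=
    (Complex.measurable_ofReal.comp (hg.comp (measurable_pi_apply i))).mul hKm
  have hGb0 : 0 ≤ Gb := (abs_nonneg _).trans (hGb 0)
  have hint : IntegrableOn (fun X : Config (n + 1) => (g (X i) : ℂ) * K X) (cellN (n + 1) ℓ) := by
    refine Measure.integrableOn_of_bounded (M := Gb * C) hvol hm.aestronglyMeasurable ?_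
    refine (ae_restrict_iff' (measurableSet_cellN _ _)).2 (Eventually.of_forall fun X hX => ?_)
    rw [norm_mul, Complex.norm_real, Real.norm_eq_abs]
    exact mul_le_mul (hGb _) (hC X hX) (norm_nonneg _) hGb0
  -- fibre integration of `g(xᵢ)K`: the inner integral is `(∫g) K`
  have h := integral_cellN_integral_cell_update i hint
  have hfib : ∀ X : Config (n + 1), ∫ y in cell ℓ, (g ((Function.update X i y) i) : ℂ) *
      K (Function.update X i y) = ((∫ y in cell ℓ, g y : ℝ) : ℂ) * K X := by
    intro X
    simp_rw [Function.update_self, hKi]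
    rw [integral_mul_const, integral_complex_ofReal]
  simp_rw [hfib] at h
  rw [integral_const_mul] at h
  -- solve for `∫ gK`
  have hℓ3 : (ℓ ^ 3 : ℝ) ≠ 0 := by positivity
  rw [Complex.real_smul] at h ⊢
  have e : ∫ X in cellN (n + 1) ℓ, (g (X i) : ℂ) * K X =
      ((ℓ ^ 3 : ℝ) : ℂ)⁻¹ * ((((∫ y in cell ℓ, g y : ℝ)) : ℂ) * ∫ X in cellN (n + 1) ℓ, K X) := by
    rw [h, ← mul_assoc, inv_mul_cancel₀ (by exact_mod_cast hℓ3), one_mul]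
  rw [e]
  push_cast
  ring

/-- **`⟨H, PᵢG⟩ = ⟨H, G⟩` for `H` independent of `xᵢ`** on `Λⁿ⁺¹` (`ℓ > 0`):
`∫_{Λⁿ⁺¹} conj(H)·PᵢG = ∫_{Λⁿ⁺¹} conj(H)·G` when `conj(H)G ∈ L¹`. [cite: Fournais2020, (2.5)] -/
theorem integral_conj_mul_sliceMean (hℓ : 0 < ℓ) (i : Fin (n + 1)) {H G : Config (n + 1) → ℂ}
    (hH : ∀ X y, H (Function.update X i y) = H X)
    (hHG : IntegrableOn (fun X => conj (H X) * G X) (cellN (n + 1) ℓ)) :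
    ∫ X in cellN (n + 1) ℓ, conj (H X) * sliceMean ℓ i G X =
      ∫ X in cellN (n + 1) ℓ, conj (H X) * G X := by
  have hset := cellN_ae_eq_boxConfig (n + 1) ℓ
  have hHG' : Integrable (fun X => conj (H X) * G X) ((volume : Measure (Config (n + 1))).restrict
      (boxConfig (n + 1) ℓ (WithLp.toLp 2 fun _ : Fin 3 => ℓ / 2))) := by
    rw [← Measure.restrict_congr_set hset]; exact hHG
  have h := integral_conj_mul_nbodyP (ℓ := ℓ) (u := (WithLp.toLp 2 fun _ : Fin 3 => ℓ / 2)) hℓ i hH hHG'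
  rw [setIntegral_congr_set hset, setIntegral_congr_set hset, sliceMean_eq_nbodyP' hℓ i]
  exact h

end Literature.MathematicalPhysics.QuantumManyBody.JelliumBoseGas
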